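import Mathlib.Data.Matrix.Basic
import Mathlib.LinearAlgebra.Matrix.Determinant.Basic
import Mathlib.LinearAlgebra.Matrix.Notation
import Mathlib.Tactic.Ring
import Mathlib.Tactic.LinearCombination
import HarnessLib

set_option linter.dupNamespace false

/-!
# Weil-type family coverage — TYPE-III WINDOWS, part J (census block b04.23): the ALGEBRAIC SKELETON of the ROW LAW (THEOREM S25.4)

research route conditional on HC_CM; not a corollary; Q11.4-sentence-2 already refuted in dim ≥ 3.

Ring 2, WEIL-TYPE FAMILY-COVERAGE CENSUS (`HOME/WEIL-FAMILY-COVERAGE.md` `## b04`, block b04.23, owner ring2-b04, gen 59; theory note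
`HOME/pub-hodge-ring2-b04/census-g59/theory/THEOREMS-S25.md` §4).  SETTING (informal, NOT formalised): a type-III sixfold `B` with definite
quaternion algebra `D = K ⊕ jK` (`K = ℚ(μ)`, `μ² = −d`, `j² = c`, `jκ = κ̄j`) and skew-hermitian class `T_D(Δ,S)` is of Weil type `(3,3)` for
`K`; THEOREM S25.4 (ROW LAW) computes its `K`-hermitian discriminant class: diagonalising the skew-hermitian form as `⊥⟨α_i⟩` with
`α_i = a_iμ + jκ_i`, the `K`-component `H` of the form has, on the block `e_iD = e_iK ⊕ e_ijK`, the Gram matrix `[[a_iμ, cκ̄_i],[−cκ_i, a_icμ]]`,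
whose determinant is `−c·Nrd(α_i)` with `Nrd(α_i) = a_i²d − cN(κ_i)`; hence `det H = (−c)³∏Nrd(α_i) ≡ −c·Δ` modulo squares and norms, and the
census row of `B` for `K` is `T_K = {p : (−1,−d)_p ε_p(D) (Δ,−d)_p = −1}`.
THIS FILE checks in the kernel the two polynomial identities of that computation, over an arbitrary commutative ring standing for `K`
(with `κ̄` an independent variable `κb` and the relations `μ² = −d`, `κκ̄ = N` as hypotheses), and the bookkeeping `(−c)³·P = (−c)·(c²·P)`
(a square factor) used to pass from rank 3 to the class `−cΔ`.  Nothing about quaternion algebras, Hilbert symbols or Hodge classes is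
formalised; `HC_CM` is used nowhere.  No `sorry`, no definitions.
-/

namespace Summit.HodgeConjecture.HodgeConjecture.Ring2.WeilCoverage

open Matrix

/-- ROW LAW, block determinant (THEOREMS-S25 §4, proof): over a commutative ring with `μ² = −d` and `κ·κ̄ = N`, the `2 × 2` Gram block
`[[aμ, cκ̄],[−cκ, acμ]]` of the `K`-component of a rank-one skew-hermitian quaternionic form `⟨aμ + jκ⟩` (`j² = c`) has determinant
`−c·(a²d − cN)` (`= −c·Nrd(aμ + jκ)`).
research route conditional on HC_CM; not a corollary; Q11.4-sentence-2 already refuted in dim ≥ 3. -/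
theorem rowLaw_block_det {R : Type*} [CommRing R] (μ κ κb a c d N : R) (hμ : μ * μ = -d) (hκ : κ * κb = N) :
    Matrix.det !![a * μ, c * κb; -(c * κ), a * c * μ] = -c * (a ^ 2 * d - c * N) := by
  rw [Matrix.det_fin_two_of]
  linear_combination (a ^ 2 * c) * hμ + (c ^ 2) * hκ

/-- The reduced norm of the pure quaternion `α = aμ + jκ`: from `α² = −a²d + cN(κ)` (the cross terms `a(μjκ + jκμ)` cancel because `μj = −jμ`)
one has `Nrd(α) = −α² = a²d − cN(κ)`.  Here only the scalar identity is recorded: if `s = −(a²) * d + c * N` (the square) then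
`−s = a² d − c N`.
research route conditional on HC_CM; not a corollary; Q11.4-sentence-2 already refuted in dim ≥ 3. -/
theorem rowLaw_nrd_of_sq {R : Type*} [CommRing R] (a c d N s : R) (hs : s = -(a ^ 2) * d + c * N) :
    -s = a ^ 2 * d - c * N := by
  rw [hs]; ring

/-- Rank three: the product of the three block determinants is `(−c)³·∏Nrd(α_i)`, and `(−c)³·P = (−c)·(c²·P)` — a square times `−c·P`; so the
`K`-discriminant class of a rank-3 form of reduced discriminant `Δ = ∏Nrd(α_i)` is `−c·Δ` modulo squares (THEOREMS-S25 §4: `a ≡ −c_K·Δ`).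
research route conditional on HC_CM; not a corollary; Q11.4-sentence-2 already refuted in dim ≥ 3. -/
theorem rowLaw_rank_three {R : Type*} [CommRing R] (c n₁ n₂ n₃ : R) :
    (-c * n₁) * (-c * n₂) * (-c * n₃) = (-c) * (c ^ 2 * (n₁ * n₂ * n₃)) := by
  ring

/-- The hermitian normalisation: multiplying the skew-hermitian `K`-form `H` (rank `2n = 6` over `K`) by `μ` multiplies the determinant by
`μ⁶ = (μ²)³ = (−d)³ = −d³ = −d·d²`; with `d = N(μ)` a norm, the class changes by the sign `(−1)^3` only — whence the census representative
`a = (−1)^3·det(μH) ≡ −c·Δ`.  Recorded: `μ² = −d → μ^6 = -(d * d ^ 2)`.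
research route conditional on HC_CM; not a corollary; Q11.4-sentence-2 already refuted in dim ≥ 3. -/
theorem rowLaw_mu_pow_six {R : Type*} [CommRing R] (μ d : R) (hμ : μ * μ = -d) : μ ^ 6 = -(d * d ^ 2) := by
  have h2 : μ ^ 2 = -d := by rw [pow_two]; exact hμ
  calc μ ^ 6 = (μ ^ 2) ^ 3 := by ring
    _ = (-d) ^ 3 := by rw [h2]
    _ = -(d * d ^ 2) := by ring

end Summit.HodgeConjecture.HodgeConjecture.Ring2.WeilCoverage
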